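import Mathlib
import HarnessLib
import Summits.RiemannHypothesis.Statement
import Literature.NumberTheory.DiophantineGeometry.NamedHypothesesRHProofs
import Literature.NumberTheory.LFunctions.RiemannHypothesisUpTo101
import Literature.NumberTheory.LFunctions.ZeroCountingDerivZetaProofs
import Literature.NumberTheory.LFunctions.ZetaOrdinateDictionary
import Literature.NumberTheory.LFunctions.ZeroStatisticsPairSums
import Literature.NumberTheory.LFunctions.ZetaArgVariation

/-!
# Splittings — Montgomery's PAIR CORRELATION forces DENSITY-ZERO off-line zeros (SPLIT-zd-bridge gen 4 §10.1(c);
# BY-PRODUCT BP-7 candidate; zero-definition raw form; CONDITIONAL-on-PCC)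

Cell rh-split, seat rh-split-zd-bridge g4 (brief sha16 f79c5f09d8bcb036), card `run/shared/lean/pub/rh-split/cards/SPLIT-zd-bridge.md`
§10; carved from `HOME/rh-split-zd-bridge/SketchG4.lean` (sha16 434c37f12f193f38: §10.1(b)+(c), the declaration
`offLine_density_tendsto_zero_of_pairCorrelation` and its dependency closure only; the seat-local `zeroFinset`,
`offLineCount`, `coincidentPairCount` SPELLED OUT; proofs otherwise verbatim), filed by rh-split-typer-1 g2 on the
lead's queue T1-Q1 (rh-split-lead g2, 2026-08-26T23:22Z; referee g2 pre-file requested).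

**Statement (CONDITIONAL on the tree-typed conjecture `MontgomeryPairCorrelation`, RH-FREE otherwise).**  With the zeros
of the box `0 < Im ρ ≤ T` enumerated WITH MULTIPLICITY by the tree's ordinates `γ_n = zetaOrdinate n` (`n < N(T)`):

* `two_le_card_indices_of_offLine` — the reflection `ρ ↦ 1 − ρ̄` sends an OFF-LINE zero to a DIFFERENT zero with the
  SAME ordinate, so every off-line zero produces a REPEATED ordinate (`#{n : γ_n = Im ρ} ≥ 2`);
* `offLineCount_le_coincidentPairCount` — COMBINATORIAL CORE: `∑_{0<Im ρ≤T, Re ρ≠1/2} m(ρ) ≤ #{(m,n) : m ≠ n, γ_m = γ_n}`;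
* `card_add_coincident_le_pairCorrelationCount` — for a window containing `0`, Montgomery's pair count contains the
  diagonal and every coincident pair: `N(T) + #coincident ≤ pairCorrelationCount α β T`;
* `offLine_density_tendsto_zero_of_pairCorrelation` — **`MontgomeryPairCorrelation → (∑_{off-line, Im ρ ≤ T} m(ρ)) / N(T) → 0`**:
  the RH-free pair-correlation conjecture (pairs of INDICES, zeros with multiplicity, the tree's `MontgomeryPairCorrelation`)
  implies that the off-line zeros have DENSITY ZERO — a COUNT about real parts (card class M3), «almost all zeros on the
  line» far beyond the proved 41 %, but NOT emptiness: no bridge to a tail `TailZd H`, hence no splitting; the (zd, bridge)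
  verdict class is UNCHANGED (barrier note).  Referee label (rh-split-ref g2, content PRE-FILE PASS 23:34Z): CONDITIONAL-on-PCC;
  «consequence of the tree's RH-free multiset typing (index pairs, atom weight 1); a density count, not a tail»
  (`MontgomeryPairCorrelation` is an open conjecture typed in the tree; nothing is assumed about it beyond the hypothesis binder).

Typer replay (rh-split-typer-1 g2): the 388-line scratch rc 0 / 0 warnings / 0 sorry; this carved raw form re-checked;
`#print axioms offLine_density_tendsto_zero_of_pairCorrelation` = [propext, Classical.choice, Quot.sound] (no F1, no
`native_decide`).

HONEST LABEL: «SPLITTING SEARCH over kernel-typed RH-EQUIVALENCES; a splitting A ∧ B ⟹ RH is CONDITIONAL bookkeeping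
unless A and B are both proved; nothing here bears on the truth of RH.»
-/

set_option linter.dupNamespace false

noncomputable section

namespace Summit.RiemannHypothesis.RiemannHypothesis.Theorems.Splittings.PairCorrelationOffLineDensity

open Complex Filter Set Topology
open scoped Real ComplexConjugate
open Literature.NumberTheory.DiophantineGeometry Literature.NumberTheory.LFunctions

/-! ## The enumeration with multiplicity: an off-line zero is a REPEATED ordinate -/


/-- Membership in the `Finset` of the box of zeros `0 < Im ρ ≤ T`. [folklore] -/
theorem mem_zeroFinset {T : ℝ} {ρ : ℂ} : ρ ∈ (zetaZeroBox_finite 0 T).toFinset ↔ ρ ∈ zetaZeroBox 0 T := by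
  rw [Set.Finite.mem_toFinset]

/-- A zero with `0 < Im s ≤ T` lies in the box. [folklore] -/
theorem mem_zetaZeroBox_of_zero {T : ℝ} {s : ℂ} (hs : riemannZeta s = 0) (h0 : 0 < s.im)
    (hT : s.im ≤ T) : s ∈ zetaZeroBox 0 T := by
  obtain ⟨hr0, hr1⟩ := re_mem_Ioo_of_riemannZeta_eq_zero_of_im_ne_zero hs h0.ne'
  exact ⟨hs, hr0.le, hr1.le, h0, hT⟩

/-- Multiplicities of zeros in the box are `≥ 1`. [folklore] -/
theorem one_le_zeroOrder_of_mem {T : ℝ} {ρ : ℂ} (hρ : ρ ∈ zetaZeroBox 0 T) :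
    1 ≤ riemannZetaZeroOrder ρ := by
  have h := (riemannZetaZeroOrder_pos_iff (ne_one_of_riemannZeta_eq_zero hρ.1)).2 hρ.1
  omega

/-- The reflection of an OFF-LINE zero of the box is a different zero of the box at the same height.
[folklore] -/
theorem reflection_ne {ρ : ℂ} (hρ : ρ.re ≠ 1 / 2) : 1 - conj ρ ≠ ρ := by
  intro h
  have := congrArg Complex.re h
  simp only [sub_re, one_re, conj_re] at this
  exact hρ (by linarith)

/-- KEY COUNT: if the box `0 < Im ρ ≤ T` contains an off-line zero at height `y`, then at least TWO
indices `n < N(T)` carry the ordinate `γ_n = y` (the zero and its reflection, each with multiplicity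
`≥ 1`; dictionary `OrdinateDictionary.card_filter_zetaOrdinate_eq`). [folklore] -/
theorem two_le_card_indices_of_offLine {T : ℝ} {ρ : ℂ} (hρ : ρ ∈ zetaZeroBox 0 T)
    (hoff : ρ.re ≠ 1 / 2) :
    2 ≤ ((Finset.range (zetaZeroCount T)).filter (fun n ↦ zetaOrdinate n = ρ.im)).card := by
  classical
  have hρZ : ρ ∈ (zetaZeroBox_finite 0 T).toFinset := mem_zeroFinset.2 hρ
  have hy : ρ.im ∈ (zetaZeroBox_finite 0 T).toFinset.image Complex.im :=
    Finset.mem_image.2 ⟨ρ, hρZ, rfl⟩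
  have hdict := OrdinateDictionary.card_filter_zetaOrdinate_eq (T := T) hy
  -- the reflection
  set ρ' : ℂ := 1 - conj ρ with hρ'
  have hρ'box : ρ' ∈ zetaZeroBox 0 T := one_sub_conj_mem_zetaZeroBox hρ
  have hρ'Z : ρ' ∈ (zetaZeroBox_finite 0 T).toFinset := mem_zeroFinset.2 hρ'box
  have hne : ρ' ≠ ρ := reflection_ne hoff
  have him' : ρ'.im = ρ.im := by simp [hρ']
  -- the pair {ρ, ρ'} sits inside the fibre over `Im ρ`
  have hsub : ({ρ', ρ} : Finset ℂ) ⊆ (zetaZeroBox_finite 0 T).toFinset.filter (fun z ↦ z.im = ρ.im) := by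
    intro z hz
    rcases Finset.mem_insert.1 hz with rfl | hz
    · exact Finset.mem_filter.2 ⟨hρ'Z, him'⟩
    · rw [Finset.mem_singleton] at hz; subst hz
      exact Finset.mem_filter.2 ⟨hρZ, rfl⟩
  have hnonneg : ∀ z ∈ (zetaZeroBox_finite 0 T).toFinset.filter (fun z ↦ z.im = ρ.im),
      0 ≤ riemannZetaZeroOrder z := by
    intro z hz
    have hz' := (Finset.mem_filter.1 hz).1
    rw [Set.Finite.mem_toFinset] at hz'
    exact zero_le_one.trans (one_le_zeroOrder_of_mem hz')
  have hle : ∑ z ∈ ({ρ', ρ} : Finset ℂ), riemannZetaZeroOrder z ≤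
      ∑ z ∈ (zetaZeroBox_finite 0 T).toFinset.filter (fun z ↦ z.im = ρ.im), riemannZetaZeroOrder z :=
    Finset.sum_le_sum_of_subset_of_nonneg hsub (fun z hz _ ↦ hnonneg z hz)
  rw [Finset.sum_pair hne] at hle
  have h1 := one_le_zeroOrder_of_mem hρ
  have h2 := one_le_zeroOrder_of_mem hρ'box
  have : (2 : ℤ) ≤ (((Finset.range (zetaZeroCount T)).filter (fun n ↦ zetaOrdinate n = ρ.im)).card : ℤ) := by
    rw [hdict]; linarith
  exact_mod_cast this

/-! ## Montgomery's RH-free pair correlation (tree form) forces DENSITY-ZERO off-line zeros -/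



/-- The off-line zeros of the box `0 < Im ρ ≤ T`, counted with multiplicity, form a non-negative integer. [folklore] -/
theorem offLineCount_nonneg (T : ℝ) : 0 ≤ (∑ ρ ∈ ((zetaZeroBox_finite 0 T).toFinset).filter (fun ρ ↦ ρ.re ≠ 1 / 2), riemannZetaZeroOrder ρ : ℤ) := by
  classical
  refine Finset.sum_nonneg fun ρ hρ ↦ ?_
  have h := (Finset.mem_filter.1 hρ).1
  exact (zero_le_one.trans (one_le_zeroOrder_of_mem (mem_zeroFinset.1 h)))

/-- COMBINATORIAL CORE: every off-line zero (with multiplicity) is paid for by an ordered pair of distinct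
indices with equal ordinates: `∑_{off-line} m(ρ) ≤ #{(m,n) : m ≠ n, γ_m = γ_n, m n < N(T)}`.
(Per height `y`: if an off-line zero sits at height `y` the fibre `{n : γ_n = y}` has `k ≥ 2` elements
and carries `k(k−1) ≥ k ≥ ∑_{Im ρ = y} m(ρ)` ordered pairs.) [folklore] -/
theorem offLineCount_le_coincidentPairCount (T : ℝ) :
    (∑ ρ ∈ ((zetaZeroBox_finite 0 T).toFinset).filter (fun ρ ↦ ρ.re ≠ 1 / 2), riemannZetaZeroOrder ρ : ℤ) ≤ (((Finset.range (zetaZeroCount T) ×ˢ Finset.range (zetaZeroCount T)).filter (fun p ↦ p.1 ≠ p.2 ∧ zetaOrdinate p.1 = zetaOrdinate p.2)).card) := by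
  classical
  set Z : Finset ℂ := (zetaZeroBox_finite 0 T).toFinset with hZdef
  set N : ℕ := zetaZeroCount T with hNdef
  set Hs : Finset ℝ := Z.image Complex.im with hHs
  -- fibres of indices and of off-line zeros over a height `y`
  let B : ℝ → Finset ℕ := fun y ↦ (Finset.range N).filter (fun n ↦ zetaOrdinate n = y)
  let E : ℝ → ℤ := fun y ↦ ∑ ρ ∈ (Z.filter (fun ρ ↦ ρ.re ≠ 1 / 2)).filter (fun ρ ↦ ρ.im = y),
    riemannZetaZeroOrder ρ
  -- (1) offLineCount = Σ_y E y
  have h1 : (∑ ρ ∈ ((zetaZeroBox_finite 0 T).toFinset).filter (fun ρ ↦ ρ.re ≠ 1 / 2), riemannZetaZeroOrder ρ : ℤ) = ∑ y ∈ Hs, E y := by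
    symm
    apply Finset.sum_fiberwise_of_maps_to
    intro ρ hρ
    exact Finset.mem_image.2 ⟨ρ, (Finset.mem_filter.1 hρ).1, rfl⟩
  -- (2) Σ_y #(B y).offDiag ≤ coincidentPairCount
  have h2 : ∑ y ∈ Hs, ((B y).offDiag).card ≤ (((Finset.range (zetaZeroCount T) ×ˢ Finset.range (zetaZeroCount T)).filter (fun p ↦ p.1 ≠ p.2 ∧ zetaOrdinate p.1 = zetaOrdinate p.2)).card) := by
    rw [← Finset.card_biUnion]
    · apply Finset.card_le_card
      intro p hp
      obtain ⟨y, -, hy⟩ := Finset.mem_biUnion.1 hp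
      rw [Finset.mem_offDiag] at hy
      obtain ⟨h1', h2', hne⟩ := hy
      have hm := Finset.mem_filter.1 h1'
      have hn := Finset.mem_filter.1 h2'
      refine Finset.mem_filter.2 ⟨Finset.mem_product.2 ⟨hm.1, hn.1⟩, hne, ?_⟩
      rw [hm.2, hn.2]
    · intro y _ y' _ hyy'
      rw [Function.onFun, Finset.disjoint_left]
      intro p hp hp'
      rw [Finset.mem_offDiag] at hp hp'
      have := (Finset.mem_filter.1 hp.1).2
      have := (Finset.mem_filter.1 hp'.1).2
      exact hyy' (by rw [← ‹zetaOrdinate p.1 = y›, ‹zetaOrdinate p.1 = y'›])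
  -- (3) per height: E y ≤ #(B y).offDiag
  have h3 : ∀ y ∈ Hs, E y ≤ (((B y).offDiag).card : ℤ) := by
    intro y hy
    rw [Finset.offDiag_card]
    have hdict : ((B y).card : ℤ) = ∑ ρ ∈ Z.filter (fun ρ ↦ ρ.im = y), riemannZetaZeroOrder ρ :=
      OrdinateDictionary.card_filter_zetaOrdinate_eq (T := T) hy
    have hnonneg : ∀ z ∈ Z.filter (fun ρ ↦ ρ.im = y), 0 ≤ riemannZetaZeroOrder z := by
      intro z hz
      exact zero_le_one.trans (one_le_zeroOrder_of_mem (mem_zeroFinset.1 (Finset.mem_filter.1 hz).1))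
    -- E y ≤ k := #(B y)
    have hEk : E y ≤ ((B y).card : ℤ) := by
      rw [hdict]
      apply Finset.sum_le_sum_of_subset_of_nonneg
      · intro z hz
        have hz' := Finset.mem_filter.1 hz
        exact Finset.mem_filter.2 ⟨(Finset.mem_filter.1 hz'.1).1, hz'.2⟩
      · exact fun z hz _ ↦ hnonneg z hz
    by_cases hE : ∃ ρ ∈ Z.filter (fun ρ ↦ ρ.im = y), ρ.re ≠ 1 / 2
    · -- an off-line zero at height y: k ≥ 2, so k ≤ k*k - k
      obtain ⟨ρ, hρ, hoff⟩ := hE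
      have hρ' := Finset.mem_filter.1 hρ
      have hbox : ρ ∈ zetaZeroBox 0 T := mem_zeroFinset.1 hρ'.1
      have hk : 2 ≤ (B y).card := by
        have := two_le_card_indices_of_offLine hbox hoff
        rw [hρ'.2] at this
        exact this
      have hsub : (B y).card ≤ (B y).card * (B y).card := Nat.le_mul_self _
      have : ((B y).card : ℤ) ≤ (((B y).card * (B y).card - (B y).card : ℕ) : ℤ) := by
        push_cast [Nat.cast_sub hsub]
        nlinarith
      exact hEk.trans this
    · -- no off-line zero at height y: E y = 0
      push Not at hE
      have hE0 : E y = 0 := by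
        apply Finset.sum_eq_zero
        intro ρ hρ
        have hρ' := Finset.mem_filter.1 hρ
        have hρ'' := Finset.mem_filter.1 hρ'.1
        exact absurd (hE ρ (Finset.mem_filter.2 ⟨hρ''.1, hρ'.2⟩)) hρ''.2
      rw [hE0]
      exact_mod_cast Nat.zero_le _
  -- assemble
  calc (∑ ρ ∈ ((zetaZeroBox_finite 0 T).toFinset).filter (fun ρ ↦ ρ.re ≠ 1 / 2), riemannZetaZeroOrder ρ : ℤ) = ∑ y ∈ Hs, E y := h1
    _ ≤ ∑ y ∈ Hs, (((B y).offDiag).card : ℤ) := Finset.sum_le_sum h3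
    _ = ((∑ y ∈ Hs, ((B y).offDiag).card : ℕ) : ℤ) := by push_cast; rfl
    _ ≤ (((Finset.range (zetaZeroCount T) ×ˢ Finset.range (zetaZeroCount T)).filter (fun p ↦ p.1 ≠ p.2 ∧ zetaOrdinate p.1 = zetaOrdinate p.2)).card) := by exact_mod_cast h2

/-- For a window containing `0` (`α ≤ 0 ≤ β`, `T ≥ 1`), Montgomery's pair count contains the diagonal
(`N(T)` pairs) and every coincident pair: `N(T) + (((Finset.range (zetaZeroCount T) ×ˢ Finset.range (zetaZeroCount T)).filter (fun p ↦ p.1 ≠ p.2 ∧ zetaOrdinate p.1 = zetaOrdinate p.2)).card) ≤ pairCorrelationCount α β T`.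
[folklore] -/
theorem card_add_coincident_le_pairCorrelationCount {α β T : ℝ} (hα : α ≤ 0) (hβ : 0 ≤ β)
    (hT : 1 ≤ T) : zetaZeroCount T + (((Finset.range (zetaZeroCount T) ×ˢ Finset.range (zetaZeroCount T)).filter (fun p ↦ p.1 ≠ p.2 ∧ zetaOrdinate p.1 = zetaOrdinate p.2)).card) ≤ pairCorrelationCount α β T := by
  classical
  have hlog : 0 ≤ Real.log T := Real.log_nonneg hT
  set N := zetaZeroCount T
  -- D := pairs with equal ordinates
  set D := (Finset.range N ×ˢ Finset.range N).filter (fun p : ℕ × ℕ ↦ zetaOrdinate p.1 = zetaOrdinate p.2)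
    with hD
  have hDcard : D.card = N + (((Finset.range (zetaZeroCount T) ×ˢ Finset.range (zetaZeroCount T)).filter (fun p ↦ p.1 ≠ p.2 ∧ zetaOrdinate p.1 = zetaOrdinate p.2)).card) := by
    rw [← Finset.card_filter_add_card_filter_not (s := D) (fun p : ℕ × ℕ ↦ p.1 = p.2)]
    congr 1
    · -- the diagonal
      have : D.filter (fun p : ℕ × ℕ ↦ p.1 = p.2) = (Finset.range N).diag := by
        ext p
        simp only [hD, Finset.mem_filter, Finset.mem_product, Finset.mem_diag, Finset.mem_range]
        constructor
        · rintro ⟨⟨⟨h1, _⟩, _⟩, h3⟩; exact ⟨h1, h3⟩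
        · rintro ⟨h1, h3⟩
          exact ⟨⟨⟨h1, by rw [← h3]; exact h1⟩, by rw [h3]⟩, h3⟩
      rw [this, Finset.diag_card, Finset.card_range]
    · rw [hD, Finset.filter_filter]
      congr 1
      ext p
      simp only [Finset.mem_filter, Finset.mem_product, Finset.mem_range]
      tauto
  have hsub : D ⊆ (zeroIndexSet T ×ˢ zeroIndexSet T).filter fun p ↦
      2 * π * α / Real.log T ≤ zetaOrdinate p.1 - zetaOrdinate p.2 ∧
        zetaOrdinate p.1 - zetaOrdinate p.2 ≤ 2 * π * β / Real.log T := by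
    intro p hp
    have hp' := Finset.mem_filter.1 hp
    refine Finset.mem_filter.2 ⟨?_, ?_, ?_⟩
    · simpa [zeroIndexSet] using hp'.1
    · rw [hp'.2, sub_self]
      exact div_nonpos_iff.2 (Or.inr ⟨by nlinarith [Real.pi_pos], hlog⟩)
    · rw [hp'.2, sub_self]
      exact div_nonneg (by nlinarith [Real.pi_pos]) hlog
  have := Finset.card_le_card hsub
  rw [hDcard] at this
  simpa [pairCorrelationCount] using this

/-- **Census consequence (class M3, not M2).** The tree's RH-FREE form of Montgomery's pair correlation
conjecture — pairs of INDICES of the enumeration with multiplicity — implies that the OFF-LINE zeros have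
density zero among all zeros: `(∑ ρ ∈ ((zetaZeroBox_finite 0 T).toFinset).filter (fun ρ ↦ ρ.re ≠ 1 / 2), riemannZetaZeroOrder ρ : ℤ) / N(T) → 0`, i.e. `N₀(T) ∼ N(T)` counted with multiplicity
(«almost all zeros lie on the critical line», far beyond the proved 41 %), because every off-line zero
is a repeated ordinate and the conjectured pair density has no atom at `0` beyond the diagonal. A COUNT
(density one), not emptiness: no bridge to `TailZd H` (card M3/M1), but not blind either.  LABEL: CONDITIONAL-on-PCC;
consequence of the tree's RH-free multiset typing (index pairs, atom weight 1); a density count, not a tail. [folklore] -/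
theorem offLine_density_tendsto_zero_of_pairCorrelation (h : MontgomeryPairCorrelation) :
    Tendsto (fun T : ℝ ↦ ((∑ ρ ∈ ((zetaZeroBox_finite 0 T).toFinset).filter (fun ρ ↦ ρ.re ≠ 1 / 2), riemannZetaZeroOrder ρ : ℤ) : ℝ) / zetaZeroCount T) atTop (𝓝 0) := by
  rw [tendsto_order]
  refine ⟨fun a ha ↦ Eventually.of_forall fun T ↦ ha.trans_le ?_, fun b hb ↦ ?_⟩
  · exact div_nonneg (by exact_mod_cast offLineCount_nonneg T) (Nat.cast_nonneg _)
  · -- window [-δ, δ] with δ = b/4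
    set δ : ℝ := b / 4 with hδ
    have hδ0 : 0 < δ := by positivity
    have hlim := h (-δ) δ (by linarith)
    have hmem : (0 : ℝ) ∈ Icc (-δ) δ := ⟨by linarith, hδ0.le⟩
    rw [if_pos hmem] at hlim
    -- the integral is at most 2δ
    have hint : (∫ u in (-δ)..δ, (1 - sineKernel u ^ 2)) ≤ 2 * δ := by
      have hb' : ‖∫ u in (-δ)..δ, (1 - sineKernel u ^ 2)‖ ≤ 1 * |δ - -δ| := by
        apply intervalIntegral.norm_integral_le_of_norm_le_const
        intro u _
        rw [Real.norm_eq_abs, abs_le]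
        exact ⟨by linarith [GUEMontgomery.pairDensity_nonneg u], GUEMontgomery.pairDensity_le_one u⟩
      have : |δ - -δ| = 2 * δ := by rw [sub_neg_eq_add, abs_of_nonneg (by linarith)]; ring
      rw [this, one_mul] at hb'
      exact (le_abs_self _).trans ((Real.norm_eq_abs _).symm.le.trans hb')
    -- eventually the pair-correlation ratio is < 1 + 3δ
    have hev := (tendsto_order.1 hlim).2 (1 + 3 * δ) (by linarith)
    have hN : ∀ᶠ T : ℝ in atTop, 1 ≤ zetaZeroCount T :=
      (tendsto_atTop.1 tendsto_zetaZeroCount_atTop_holds) 1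
    filter_upwards [hev, hN, eventually_ge_atTop (1 : ℝ)] with T hT hNT hT1
    have hNpos : (0 : ℝ) < zetaZeroCount T := by exact_mod_cast hNT
    have hle := card_add_coincident_le_pairCorrelationCount (α := -δ) (β := δ) (T := T)
      (by linarith) hδ0.le hT1
    have hoff := offLineCount_le_coincidentPairCount T
    -- (N + C) / N < 1 + 3δ  ⟹  C < 3δ N  ⟹  offLine / N < b
    have hle' : (zetaZeroCount T : ℝ) + (((Finset.range (zetaZeroCount T) ×ˢ Finset.range (zetaZeroCount T)).filter (fun p ↦ p.1 ≠ p.2 ∧ zetaOrdinate p.1 = zetaOrdinate p.2)).card) ≤ pairCorrelationCount (-δ) δ T := by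
      exact_mod_cast hle
    have hratio : ((zetaZeroCount T : ℝ) + (((Finset.range (zetaZeroCount T) ×ˢ Finset.range (zetaZeroCount T)).filter (fun p ↦ p.1 ≠ p.2 ∧ zetaOrdinate p.1 = zetaOrdinate p.2)).card)) / zetaZeroCount T < 1 + 3 * δ :=
      lt_of_le_of_lt (div_le_div_of_nonneg_right hle' hNpos.le) hT
    rw [div_lt_iff₀ hNpos] at hratio ⊢
    have hoff' : ((∑ ρ ∈ ((zetaZeroBox_finite 0 T).toFinset).filter (fun ρ ↦ ρ.re ≠ 1 / 2), riemannZetaZeroOrder ρ : ℤ) : ℝ) ≤ (((Finset.range (zetaZeroCount T) ×ˢ Finset.range (zetaZeroCount T)).filter (fun p ↦ p.1 ≠ p.2 ∧ zetaOrdinate p.1 = zetaOrdinate p.2)).card) := by exact_mod_cast hoff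
    nlinarith

end Summit.RiemannHypothesis.RiemannHypothesis.Theorems.Splittings.PairCorrelationOffLineDensity

end
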